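import Literature.NumberTheory.DiophantineGeometry.BcgpSwitchExistsModularAbelianSurface
import Literature.NumberTheory.FaltingsSerre.ParamodularBridge
import Literature.NumberTheory.GaloisRepresentations.ResidualGaloisRep
import Literature.NumberTheory.GaloisRepresentations.GSp4BigImage
import HarnessLib

/-!
# Boxer–Calegari–Gee–Pilloni 2021, Theorem 1.1.7 with Proposition 10.1.3 (1): abelian surfaces
# over `ℚ`, good ordinary at `3` with unit-root eigenvalues distinct mod `3`, whose mod-`3`
# representation is vast, tidy and INDUCED from a real quadratic field unramified at `3`, are modular

Topic `Literature/NumberTheory/DiophantineGeometry` (next to the BCGP-2025 facts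
`Bcgp2025ModThreeSurjectiveModular.lean`, `BcgpResiduallyA5bModular.lean`, whose clause shapes it
repeats). ONE named fact (D-0014), no proof, no new definition: the modularity lifting theorem of
G. Boxer, F. Calegari, T. Gee, V. Pilloni, *Abelian surfaces over totally real fields are
potentially modular*, Publ. Math. IHÉS **134** (2021) 153–501 [BoxerEtAl2021] AS IT APPLIES TO
ABELIAN SURFACES — Theorem 1.1.7 (p. 158) = Proposition 10.1.1 (p. 472) with the residual
modularity hypothesis DISCHARGED by Proposition 10.1.3 (pp. 473–474), case (1) (`p = 3`, induction
from a real quadratic field) — over `F = ℚ` (the case the venture cell `pub-residmod` certifies;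
`run/shared/lean/pub/pub-residmod/lit/BCGP-AS-PRINTED.md` §A3, printed IHÉS text
`paper:url-00708d1511c4`, page = file + 152).  The big-image hypothesis "vast and tidy" uses the
definitions of `Literature/NumberTheory/GaloisRepresentations/GSp4BigImage.lean` (Def. 7.5.2,
7.5.6, 7.5.11 as printed).

## The printed statements

* Theorem 1.1.7 (p. 158 L8–27; "proved in §10, see Proposition 10.1.1"): "Let `F` be a totally
  real field in which `p > 2` splits completely. Let `A/F` be an abelian surface with good
  ordinary reduction at all places `v|p`, and suppose that, at each `v|p`, the unit root
  crystalline eigenvalues are distinct modulo `p`. Assume that `A` admits a polarization of degree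
  prime to `p`. Let `ρ̄_{A,p} : G_F → GSp₄(𝔽_p)` denote the dual of the mod-`p` Galois
  representation associated to `A[p]`, and assume that `ρ̄_{A,p}` is vast and tidy in the sense of
  Definitions 7.5.6 and 7.5.11. Assume that `ρ̄_{A,p}` is ordinarily modular, in the sense that
  there exists an automorphic representation `π` of `GSp₄/F` of parallel weight `2` and central
  character `|·|²` which is ordinary at all `v|p`, such that `ρ̄_{π,p} ≅ ρ̄_{A,p}`, and
  `ρ_{π,p}|_{G_{F_v}}` is pure for all finite places `v` of `F`. Then `A` is modular, corresponding
  to a Hilbert–Siegel eigenform of parallel weight two. Moreover, Proposition 10.1.3 shows that the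
  modularity hypotheses on `ρ̄_{A,p}` can be omitted in the following situations: (1) `p = 3`, and
  `ρ̄_{A,3}` is induced from a 2-dimensional representation with inverse cyclotomic determinant
  defined over a totally real quadratic extension `E/F` in which `3` is unramified. (2) `p = 5`, …
  (3) `ρ̄_{A,p}` is induced from a character of a quartic CM field `H/F` in which `p` splits
  completely."
* Proposition 10.1.3 (p. 473 L32 – p. 474 L4): "Let `F` be a totally real field in which `p > 2`
  splits completely. Let `ρ̄_p : G_F → GSp₄(𝔽_p)` be an absolutely irreducible representation with
  similitude factor `ε̄⁻¹` which is vast and tidy and `p`-distinguished weight 2 ordinary. Suppose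
  furthermore that either: (1) `p = 3`, and `ρ̄₃` is induced from a 2-dimensional representation
  with inverse cyclotomic determinant over a totally real quadratic extension `E/F` in which `3`
  is unramified. … Then `ρ̄_p` is ordinarily modular, that is, there exists `π` of parallel weight
  `2` and central character `|·|²` which is unramified and ordinary at all `v|p`, such that
  `ρ̄_{π,p} ≅ ρ̄`, and `ρ_{π,p}|_{G_{F_v}}` is pure for all finite places `v` of `F`."  Proof of
  Proposition 10.1.1 (p. 473 L2–9): "The assumption that `A` admits a polarization of degree
  prime to `p` implies that the image of `ρ_{A,p}` lands in `GSp₄(ℤ_p)` and `ρ̄_{A,p}` lands in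
  `GSp₄(𝔽_p)`. … The assumption that `A` has good ordinary reduction for all `v|p` and distinct
  unit root crystalline eigenvalues for all `v|p` implies that the representations `ρ̄_{A,p}`
  restricted to `G_{F_v}` are `p`-distinguished weight 2 ordinary. Prop 10.1.1 is then an
  immediate consequence of Theorem 8.4.1."  "modular" (p. 159 L11–15): "a holomorphic weight 2
  Hilbert–Siegel modular cuspidal eigenform `f` (for the group `GSp₄/F`) associated to `A` in the
  sense that we have an equality of `L`-functions `L(f, s) = L(H¹(A), s)`"; such an `A` "satisfies
  the paramodular conjecture" (Lemma 10.3.1, p. 482) and its `π` is of general type, so it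
  transfers to a cuspidal automorphic representation of `GL₄` (§2.9 ibid.; [BoxerCalegariGeePilloni2025,
  §1.8.22, §1.8.24]) — the `GL₄` form recorded below, as in every BCGP fact of the tree.

## Rendering (`F = ℚ`, `p = 3`; clause by clause)

HYPOTHESES on `A : AbelianVariety ℚ`, `A.dim = 2`, a torsion frame `(ρ₀, e)` of `A[3](ℚ̄)` and
`ρb = ρ₀^∨ = FramedRep.dual ρ₀` ("the dual of the mod-`p` Galois representation associated to
`A[p]`" — literally the printed `ρ̄_{A,3}`):
* (i) "good ordinary reduction at all places `v | 3`": `A.HasGoodOrdinaryReductionAt v`.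
* (ii) "at each `v|p`, the unit root crystalline eigenvalues are distinct modulo `p`", in the
  COEFFICIENT form the source itself prints (proof of Lemma 9.2.5, p. 461 L31–41, verbatim): "Fix a
  prime `l ≠ p`. The characteristic polynomial of `ρ_{A,l}(Frob_v)` is of the form
  `x⁴ − a₁x³ + a₂x² − pa₁x + p²` where `a₁, a₂` are integers. Then `A` has good ordinary reduction at
  `v` if and only if `p ∤ a₂`. If this holds, then we see that `ρ̄_{A,p}|_{G_{F_v}}` will be
  `p`-distinguished weight 2 ordinary if and only if `a₁² − 4a₂` is not divisible by `p`."  Rendered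
  with the tree's `AbelianVariety.HasGoodEulerFactorAt A 3 L` (`Automorphic/Paramodular/Paramodularity.lean`:
  for every `ℓ ≠ 3` and every frame of `ρ_{A,ℓ} ⊗ ℚ_ℓ` on the Tate module, unramified at `3` with
  arithmetic-Frobenius characteristic polynomial `X⁴ L(1/X)`) for
  `L = lPolynomialOfSurface 3 a₁ a₂ = 1 − a₁T + a₂T² − 3a₁T³ + 9T⁴` (`FaltingsSerre/ParamodularBridge.lean`,
  the shape the cell's certificates and `Summits/Ventures/ResidMod` consumers use), plus
  `3 ∤ a₂` and `3 ∤ a₁² − 4a₂` — so (ii) as typed literally contains "good ordinary" again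
  (harmless next to (i)) and the residual distinctness `ᾱ ≠ β̄` of the unit roots (`x⁴ − a₁x³ + a₂x²
  ≡ x²(x − ᾱ)(x − β̄) mod 3`).
* (iii) "`A` admits a polarization of degree prime to `3`", rendered by its printed use (proof of
  Prop. 10.1.1: "`ρ̄_{A,p}` lands in `GSp₄(𝔽_p)`"; multiplier `ε̄⁻¹`, Def. 2.8.2): an invertible
  alternating `J ∈ M₄(𝔽₃)` with `ρb(σ)ᵀ J ρb(σ) = ε̄(σ)⁻¹ J` — the clause of the BCGP-2025 siblings
  (`bcgp2025_modThreeSurjective_modular_abelianSurface`), see their docstrings (Weil pairing of a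
  prime-to-`3` polarisation; `weilPairing_rationalTateModule`).
* (iv) "`ρ̄_{A,3}` is vast and tidy in the sense of Definitions 7.5.6 and 7.5.11":
  `ρb.IsVast J 3 ∧ ρb.IsTidy J` (`GSp4BigImage.lean`, the printed definitions; same `J`).
* (v) Prop. 10.1.3: "absolutely irreducible" — `IsAbsIrreducible ρb` (implied by vast; kept, as
  printed); "`p`-distinguished weight 2 ordinary" is, as printed in the proof of Prop. 10.1.1, the
  consequence of (i)–(ii) and is not a separate clause of Theorem 1.1.7.
* (vi) case (1): "`ρ̄_{A,3}` is induced from a 2-dimensional representation with inverse cyclotomic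
  determinant defined over a totally real quadratic extension `E/ℚ` in which `3` is unramified":
  there are a squarefree integer `d > 1` with `3 ∤ d` (so `E = ℚ(√d)` is REAL quadratic with
  `disc E ∈ {d, 4d}` prime to `3`) and a square root `x` of `d` in `ℚ̄` (`G_E = Stab(x) ≤ Γ_ℚ`), and
  a frame `g ∈ GL₄(𝔽̄₃)` in which `ρb ⊗ 𝔽̄₃` is BLOCK DIAGONAL (`2+2`) on `G_E` with upper-left block
  of determinant `ε̄⁻¹` (the 2-dimensional `ϱ` with `det ϱ = ε̄⁻¹`) and BLOCK ANTI-DIAGONAL off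
  `G_E` — which is exactly `ρ̄ ≅ Ind_{G_E}^{G_ℚ} ϱ` (`𝔽̄₃⁴ = V ⊕ σV` with `G_E`-stable summands swapped
  by `Γ_ℚ ∖ G_E`).
CONCLUSION: verbatim the `GL₄` almost-everywhere clause of the siblings (for every prime `p`,
framed dual `r` of `V_p(A)`, `ι : ℚ̄_p ≃ ℂ`: an L-algebraic cuspidal `π` on `GL₄(𝔸_ℚ)` whose Satake
parameters give `det(X − r(Frob_v))` at almost all `v`) — WEAKER than the printed conclusion
("corresponding to a Hilbert–Siegel eigenform of parallel weight two"; "ordinary `π′` with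
`ρ_{π′,p} ≅ ρ_{A,p}`", Prop. 10.1.1; paramodular of level `cond(A)`, Lemma 10.3.1), which needs
`GSp₄` automorphic vocabulary the tree does not have.
`-- TODO(general form): totally real F with p split completely; cases (2) (p = 5, ϱ valued in GL₂(𝔽₅)) and (3) (induction from a quartic CM field) of Prop. 10.1.3; the GSp₄/paramodular conclusion.`

## Status

Conditional in print on Arthur's classification for `GSp₄` (§1.3 / §2.9 ibid.; the tree's
`Automorphic/Arthur2013/Downstream.lean`, edge `E_BCGP`); the `p = 3` case of Lemma 7.5.15 and
Lemma 7.5.21 behind "vast" are Magma computations in print.  Residual modularity in case (1) rests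
on [BLGG13, Thm A], Langlands–Tunnell and the odd Artin conjecture for totally real fields
[PS16b] (proof of Prop. 10.1.3, p. 474).  Consumed as `(h : bcgp2021_modThreeInduced_modular_abelianSurface)`.
SIZE XL to discharge (Theorem 8.4.1: higher Hida theory and Taylor–Wiles patching for `GSp₄`).

## References

* [BoxerEtAl2021] G. Boxer, F. Calegari, T. Gee, V. Pilloni, Publ. Math. IHÉS 134 (2021): Thm
  1.1.7 (p. 158), Prop. 10.1.1 and its proof (pp. 472–473), Remark 10.1.2, Prop. 10.1.3 and its
  proof (pp. 473–475), Thm 8.4.1 (pp. 452–453), Def. 2.8.2 (p. 195), Defs 7.3.1, 7.5.2, 7.5.6,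
  7.5.11, Def. 9.2.3 / Remark 9.2.4 (good primes, p. 461), proof of Lemma 9.2.5 (p. 461 L31–41: the
  criterion `p ∤ a₂`, `p ∤ a₁² − 4a₂`), Lemma 10.3.1 (p. 482), p. 159 ("modular").
* [BrumerEtAl2019] A. Brumer, A. Pacetti, C. Poor, G. Tornaría, J. Voight, D. Yuen, *On the
  paramodularity of typical abelian surfaces*, Algebra Number Theory 13 (2019), (4.1.5) (the Euler
  factor shape `lPolynomialOfSurface`).
* [BoxerCalegariGeePilloni2025] G. Boxer, F. Calegari, T. Gee, V. Pilloni, *Modularity theorems for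
  abelian surfaces*, arXiv:2502.20645: §1.8.22–1.8.24 (transfer to `GL₄`, notions of modularity;
  numbering as verified in `lit/LIT2-RESIDUAL-MODULARITY.md` §8).
* [Milne1986AbelianVarieties] J. S. Milne, *Abelian varieties* (1986), §16 (Weil pairing).
-/

namespace Literature.NumberTheory.DiophantineGeometry

open CategoryTheory IsDedekindDomain
open scoped NumberField Matrix
open Literature.NumberTheory.GaloisRepresentations Literature.NumberTheory.Automorphic
open Literature.AlgebraicGeometry.Motives (AbelianVariety)

/-- **Boxer–Calegari–Gee–Pilloni 2021, Theorem 1.1.7 with Proposition 10.1.3 (1)** (`F = ℚ`,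
`p = 3`; `GL₄` almost-everywhere form). Every abelian surface `A/ℚ` (`AbelianVariety ℚ`,
`dim A = 2`) such that, for a torsion frame `(ρ₀, e)` of `A[3](ℚ̄)` and `ρb = ρ₀^∨` (the printed
`ρ̄_{A,3}`, "the dual of the mod-3 Galois representation associated to `A[3]`"): (i) `A` has good
ordinary reduction at `3`; (ii) "the unit root crystalline eigenvalues are distinct modulo `3`" in the
printed coefficient form (proof of Lemma 9.2.5, p. 461): the good Euler factor at `3` is
`1 − a₁T + a₂T² − 3a₁T³ + 9T⁴` (`HasGoodEulerFactorAt`) with `3 ∤ a₂` and `3 ∤ a₁² − 4a₂`; (iii) `ρb` is symplectic for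
an invertible alternating `J` with multiplier `ε̄⁻¹` ("a polarization of degree prime to `3`", as
used on p. 473); (iv) `ρb` is vast and tidy (Defs 7.5.6, 7.5.11: `IsVast`, `IsTidy` of
`GSp4BigImage.lean`); (v) `ρb` is absolutely irreducible; (vi) `ρb ⊗ 𝔽̄₃` is induced from a
2-dimensional representation of determinant `ε̄⁻¹` of `G_E`, `E = ℚ(√d)` real quadratic with
`3 ∤ d` squarefree (block diagonal on `G_E = Stab(√d)`, block anti-diagonal off it) — is MODULAR:
for every prime `p`, every framed dual `r` of `V_p(A)` and every `ι : ℚ̄_p ≃ ℂ` there is an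
L-algebraic cuspidal automorphic representation of `GL₄(𝔸_ℚ)` whose Satake parameters give
`det(X − r(Frob_v))` at all but finitely many `v` (VERBATIM the conclusion clause of
`bcgp_residuallyA5b_modular_abelianSurface`; weaker than the printed Hilbert–Siegel/paramodular
conclusion).  Depends in print on Arthur's classification for `GSp₄`.  Users take
`(h : bcgp2021_modThreeInduced_modular_abelianSurface)`.  Named fact (D-0014), not proved in the
tree.
[cite: BoxerEtAl2021, Thm 1.1.7 (p. 158) = Prop. 10.1.1 (p. 472) with Prop. 10.1.3 (1) (pp. 473–474); proof of Prop. 10.1.1 (p. 473); proof of Lemma 9.2.5 (p. 461: p ∤ a₂, p ∤ a₁² − 4a₂); Defs 7.5.6, 7.5.11; Def. 2.8.2; p. 159 (modular)]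
[cite: BoxerCalegariGeePilloni2025, §1.8.22–1.8.24 (transfer to GL₄)] -/
def bcgp2021_modThreeInduced_modular_abelianSurface : Prop :=
  ∀ (A : AbelianVariety ℚ), A.dim = 2 →
    ∀ (ρ₀ : FramedGaloisRep ℚ (ZMod 3) 4) (e : A.geomTorsion (3 : ℕ) ≃+ (Fin 4 → ZMod 3))
      (ρb : FramedGaloisRep ℚ (ZMod 3) 4),
      (∀ (σ : Field.absoluteGaloisGroup ℚ) (P : A.geomTorsion (3 : ℕ)),
        e (σ • P) = ((ρ₀ σ : GL (Fin 4) (ZMod 3)) : Matrix (Fin 4) (Fin 4) (ZMod 3)) *ᵥ e P) →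
      FramedRep.dual ρ₀ = ρb →
    -- (i): good ordinary reduction at `3`
    (∀ v : HeightOneSpectrum (𝓞 ℚ), ((3 : ℕ) : 𝓞 ℚ) ∈ v.asIdeal →
      A.HasGoodOrdinaryReductionAt v) →
    -- (ii): the unit root eigenvalues of Frobenius at `3` are distinct modulo `3` — in the printed
    -- coefficient form of the proof of Lemma 9.2.5 (p. 461): `L₃(A,T) = 1 − a₁T + a₂T² − 3a₁T³ + 9T⁴`
    -- with `3 ∤ a₂` ("good ordinary") and `3 ∤ a₁² − 4a₂` ("p-distinguished weight 2 ordinary")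
    (∃ a₁ a₂ : ℤ,
      A.HasGoodEulerFactorAt 3
          ((Literature.NumberTheory.FaltingsSerre.lPolynomialOfSurface 3 a₁ a₂).map
            (Int.castRingHom ℚ)) ∧
        ¬ (3 : ℤ) ∣ a₂ ∧ ¬ (3 : ℤ) ∣ a₁ ^ 2 - 4 * a₂) →
    -- (iii)+(iv)+(v): `ρ̄_{A,3}` is `GSp₄(𝔽₃)`-valued with multiplier `ε̄⁻¹`, vast, tidy,
    -- absolutely irreducible
    (∃ J : Matrix (Fin 4) (Fin 4) (ZMod 3), Jᵀ = -J ∧ IsUnit J.det ∧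
      (∀ σ : Field.absoluteGaloisGroup ℚ,
        (ρb σ).valᵀ * J * (ρb σ).val =
          (((modPCyclotomicCharacterZMod ℚ 3 σ)⁻¹ : (ZMod 3)ˣ) : ZMod 3) • J) ∧
      ρb.IsVast J 3 ∧ ρb.IsTidy J) →
    IsAbsIrreducible (ρb : Field.absoluteGaloisGroup ℚ →* GL (Fin 4) (ZMod 3)) →
    -- (vi): case (1) of Prop. 10.1.3 — induced from a real quadratic field unramified at `3`
    (∃ (d : ℤ) (x : AlgebraicClosure ℚ) (g : GL (Fin 4) (AlgebraicClosure (ZMod 3))),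
      Squarefree d ∧ 1 < d ∧ ¬ (3 : ℤ) ∣ d ∧ x ^ 2 = (d : AlgebraicClosure ℚ) ∧
      ∀ (τ : Field.absoluteGaloisGroup ℚ) (M : GL (Fin 4) (AlgebraicClosure (ZMod 3))),
        M = g⁻¹ *
          Matrix.GeneralLinearGroup.map (algebraMap (ZMod 3) (AlgebraicClosure (ZMod 3))) (ρb τ) *
            g →
        (τ • x = x →
          (∀ i j : Fin 4, ((i : ℕ) < 2 ↔ ¬ (j : ℕ) < 2) → M.val i j = 0) ∧
          M.val 0 0 * M.val 1 1 - M.val 0 1 * M.val 1 0 =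
            algebraMap (ZMod 3) (AlgebraicClosure (ZMod 3))
              (((modPCyclotomicCharacterZMod ℚ 3 τ)⁻¹ : (ZMod 3)ˣ) : ZMod 3)) ∧
        (τ • x ≠ x → ∀ i j : Fin 4, ((i : ℕ) < 2 ↔ (j : ℕ) < 2) → M.val i j = 0)) →
    -- conclusion: `A` is modular (`GL₄` almost-everywhere form)
    ∀ (p : ℕ) [Fact p.Prime] (b : Module.Basis (Fin 4) ℚ_[p] (A.rationalTateModule p))
      (r : FramedGaloisRep ℚ (PadicAlgCl p) 4),
      (∀ g : Field.absoluteGaloisGroup ℚ,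
        (r g).val =
          ((LinearMap.toMatrix b b (A.rationalTateRep p g⁻¹)).map
            (algebraMap ℚ_[p] (PadicAlgCl p))).transpose) →
      ∀ (hcpt : isCompact_glFiniteIntegralLevel 4 ℚ) (ι : PadicAlgCl p ≃+* ℂ),
        ∃ π : CuspidalAutomorphicRepData 4 ℚ hcpt, π.1.IsLAlgebraic ∧
          ∀ᶠ v : HeightOneSpectrum (𝓞 ℚ) in Filter.cofinite, ∃ a : Multiset ℂ,
            π.1.HasSatakeParamAt v a ∧ r.IsUnramifiedAt v ∧
              r.HasFrobCharpolyAt v (arithFrobPolyOfSatake ι v.residueCard 1 a)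

end Literature.NumberTheory.DiophantineGeometry
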